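import Summits.FinalStateConjecture.FinalStateConjecture.Statement
import Literature.Geometry.Lorentzian.QuasiFinalStateDecomposition
import HarnessLib

/-!
# Stub `stub_upgradeUniform` of line `inflow-ledger-open-system` of crux `Capture`
# (stmt-FinalStateConjecture-10115): the orbital UPGRADE in its uniform (same-charts) form — PROVED

Line `inflow-ledger-open-system` (`Summits/FinalStateConjecture/FinalStateConjecture/Cruxes/Capture/Lines/
inflow_ledger_open_system.lean`, skeleton v3) splits the crux `Capture` into LEDGER → SHELL → OPEN →
UPGRADE.  Wave 1 found the planner's per-`δ` UPGRADE ("a `δ`-quasi decomposition within a fixed window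
for every `δ > 0` ⇒ settles") MIS-STATED: it hands an unrelated chart system for each `δ`, so one
`FinalStateDecomposition` needs hole identification across `δ`, a Kerr–Schild chart rigidity lemma and
chart patching in time with re-derived covering clauses — GR, not bookkeeping.  The repaired statement
(v3) asks OPEN for ONE chart system that is `δ`-quasi for every `δ > 0` IN THE SAME CHARTS; the
upgrade is then genuinely soft and is proved here, fully expanded (Theses-free): the chart system is
typed as a `⊤`-quasi `C²` decomposition `q` (chart geometry, separation, sublinear excision, covering;
closeness vacuous at `⊤`) with `N ≤ N₀` holes, labels in `[m₁, m₁⁻¹] × {|a| ≤ χ₁ M}`, growing radii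
`Rᵢ` with the exhaustive covering clause, and eventual `δ`-closeness for every `δ > 0` of the near
zones (every `R`), the flat slabs and the near zones out to `Rᵢ(τ)`; conclusion = the settling clause
of the Statement verbatim.  Proof: same charts (`QuasiFinalStateDecomposition.toFinalStateDecomposition`,
p124138), `Tendsto ↔ ∀ δ > 0, eventually ≤ δ` in `ℝ≥0∞` (`ENNReal.tendsto_nhds_zero`), sub-extremality
from `|aᵢ| ≤ χ₁ Mᵢ < Mᵢ`; `charted` and the certified regions agree by `rfl`.  The Statement's
`HasExhaustiveCharts` (2026-08-16 form) also asks the radii to tend to `+∞` and to stay above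
`max(r₊, 0) + 1`: this is free — near-zone convergence for EVERY fixed radius yields, by a diagonal
argument (`exists_nat_radius_tendsto`), integer radii `nᵢ(τ) → ∞` with the deviation out to `nᵢ(τ)`
still tending to `0`; the radii `max(Rᵢ, nᵢ, max(r₊,0)+1)` then work, the truncated deviation being
monotone in the radius and the certified regions growing with the radii (covering clause inherited).

References: Klainerman, C. R. Mécanique 353 (2025), §2.3 (orbital vs asymptotic stability);
DHRT arXiv:2104.08222, §1 (chart/deviation vocabulary). [DafermosHolzegelRodnianskiTaylor2021]
-/

noncomputable section

-- the doubled `FinalStateConjecture` path component is the summit/problem naming scheme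
set_option linter.dupNamespace false

namespace Summit.FinalStateConjecture.FinalStateConjecture.Theorems.BartnikGapSettling.Capture

open Set Filter Function Topology
open scoped Manifold ContDiff ENNReal Topology
open Literature.Geometry.Lorentzian

/-! ### Bookkeeping lemmas -/

/-- `J⁻` is monotone in the set: `S ⊆ T → J⁻(S) ⊆ J⁻(T)` (the causal past is the causal future for
the reversed time orientation, and `J⁺` is monotone, `LorentzianMetric.causalFuture_mono`).
O'Neill 1983, Ch. 14, p. 403. [folklore] -/
private theorem causalPast_mono (𝓢 : Spacetime 4) {S T : Set 𝓢.carrier} (h : S ⊆ T) :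
    𝓢.metric.causalPast 𝓢.timeOrientation S ⊆ 𝓢.metric.causalPast 𝓢.timeOrientation T := by
  unfold LorentzianMetric.causalPast
  exact LorentzianMetric.causalFuture_mono h

/-- The certified late region grows with the near-zone radii. [folklore] -/
private theorem certifiedLate_mono {𝓢 : Spacetime.{0} 4} {O : Set 𝓢.carrier} {k : ℕ}
    (d : FinalStateDecomposition 𝓢 O k) {R R' : Fin d.N → ℝ → ℝ} (h : ∀ i τ, R i τ ≤ R' i τ)
    (τ₁ : ℝ) :
    Summit.FinalStateConjecture.certifiedLate d R τ₁ ⊆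
      Summit.FinalStateConjecture.certifiedLate d R' τ₁ :=
  union_subset_union_right _ <| iUnion_mono fun i ↦ image_mono fun _ hx ↦ ⟨hx.1, hx.2.trans (h i _)⟩

/-- The certified slab grows with the near-zone radii. [folklore] -/
private theorem certifiedSlab_mono {𝓢 : Spacetime.{0} 4} {O : Set 𝓢.carrier} {k : ℕ}
    (d : FinalStateDecomposition 𝓢 O k) {R R' : Fin d.N → ℝ → ℝ} (h : ∀ i τ, R i τ ≤ R' i τ)
    (τ₁ : ℝ) :
    Summit.FinalStateConjecture.certifiedSlab d R τ₁ ⊆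
      Summit.FinalStateConjecture.certifiedSlab d R' τ₁ :=
  union_subset_union_right _ <|
    iUnion_mono fun i ↦ image_mono ((d.background i).truncTimeSlab_mono (h i τ₁) τ₁)

/-- **Diagonal growth.** If `f n τ → 0` as `τ → ∞` for every fixed `n : ℕ`, then there are integers
`g τ → ∞` with `f (g τ) τ → 0`: choose thresholds `Tₙ` beyond which `f n ≤ (n+1)⁻¹`, a monotone
majorant `Sₙ ≥ max(n, Tₙ)`, and let `g τ + 1` be the least `n` with `τ < Sₙ`. [folklore] -/
theorem exists_nat_radius_tendsto {f : ℝ → ℝ → ℝ≥0∞} (hf : ∀ n : ℕ, Tendsto (f n) atTop (𝓝 0)) :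
    ∃ g : ℝ → ℕ, Tendsto g atTop atTop ∧ Tendsto (fun τ ↦ f (g τ) τ) atTop (𝓝 0) := by
  -- thresholds: beyond `T n`, `f n ≤ (n+1)⁻¹`
  have hT : ∀ n : ℕ, ∃ T : ℝ, ∀ τ ≥ T, f n τ ≤ ((n : ℝ≥0∞) + 1)⁻¹ := fun n ↦
    Filter.eventually_atTop.1 (ENNReal.tendsto_nhds_zero.1 (hf n) _
      (ENNReal.inv_pos.2 (ENNReal.add_ne_top.2 ⟨ENNReal.natCast_ne_top n, ENNReal.one_ne_top⟩)))
  choose T hT using hT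
  -- a monotone majorant `S n ≥ max (n, T n)`
  set S : ℕ → ℝ := fun n ↦ (n : ℝ) + ∑ k ∈ Finset.range (n + 1), max (T k) 0 with hS
  have hS_mono : Monotone S := fun m n hmn ↦
    add_le_add (Nat.cast_le.2 hmn)
      (Finset.sum_le_sum_of_subset_of_nonneg (Finset.range_mono (Nat.succ_le_succ hmn))
        fun k _ _ ↦ le_max_right _ _)
  have hS_ge : ∀ n : ℕ, (n : ℝ) ≤ S n := fun n ↦
    le_add_of_nonneg_right (Finset.sum_nonneg fun k _ ↦ le_max_right _ _)
  have hTS : ∀ n, T n ≤ S n := fun n ↦ by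
    have h1 : max (T n) 0 ≤ ∑ k ∈ Finset.range (n + 1), max (T k) 0 :=
      Finset.single_le_sum (f := fun k ↦ max (T k) 0) (fun k _ ↦ le_max_right _ _)
        (Finset.self_mem_range_succ n)
    exact (le_max_left _ _).trans (h1.trans (le_add_of_nonneg_left n.cast_nonneg))
  have hex : ∀ τ : ℝ, ∃ n : ℕ, τ < S n := fun τ ↦
    ⟨⌊τ⌋₊ + 1, (Nat.lt_floor_add_one τ).trans_le (by exact_mod_cast hS_ge (⌊τ⌋₊ + 1))⟩
  -- `S n ≤ τ` forces the least index with `τ < S _` above `n`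
  have hkey : ∀ (τ : ℝ) (n : ℕ), S n ≤ τ → n < Nat.find (hex τ) := fun τ n hn ↦ by
    by_contra h
    exact absurd ((hS_mono (not_lt.1 h)).trans hn) (not_le.2 (Nat.find_spec (hex τ)))
  refine ⟨fun τ ↦ Nat.find (hex τ) - 1, tendsto_atTop_atTop.2 fun n ↦ ⟨S (n + 1), fun τ hτ ↦ ?_⟩,
    ENNReal.tendsto_nhds_zero.2 fun ε hε ↦ ?_⟩
  · have := hkey τ (n + 1) hτ
    omega
  · obtain ⟨n, hn⟩ := ENNReal.exists_inv_nat_lt hε.ne'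
    refine Filter.eventually_atTop.2 ⟨S n, fun τ hτ ↦ ?_⟩
    have h1 : n < Nat.find (hex τ) := hkey τ n hτ
    have h2 : S (Nat.find (hex τ) - 1) ≤ τ :=
      not_lt.1 (Nat.find_min (hex τ) (show Nat.find (hex τ) - 1 < Nat.find (hex τ) by omega))
    have h3 : (n : ℝ≥0∞) ≤ ((Nat.find (hex τ) - 1 : ℕ) : ℝ≥0∞) + 1 := by
      exact_mod_cast (show n ≤ Nat.find (hex τ) - 1 + 1 by omega)
    calc f ((Nat.find (hex τ) - 1 : ℕ) : ℝ) τ ≤ (((Nat.find (hex τ) - 1 : ℕ) : ℝ≥0∞) + 1)⁻¹ :=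
          hT _ τ ((hTS _).trans h2)
      _ ≤ (n : ℝ≥0∞)⁻¹ := ENNReal.inv_le_inv.2 h3
      _ ≤ ε := hn.le

/-! ### The upgrade -/

/-- **UPGRADE, uniform form (stub `stub_upgradeUniform`, proved)**: in an MGHD of an admissible datum,
ONE chart system of the self-determined exterior with `N ≤ N₀` holes and labels in the window
`[m₁, m₁⁻¹] × {|a| ≤ χ₁ M}`, `χ₁ < 1`, which is `δ`-quasi for EVERY `δ > 0` in the same charts (near
zones for every `R`, flat slabs, near zones out to growing radii `Rᵢ(τ)` carrying the exhaustive
covering clause) gives the settling clause of the Statement: a `C²` final state decomposition with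
sub-extremal holes, `O = exteriorOf d.charted`, `HasExhaustiveCharts d`.  Klainerman 2025, §2.3
(orbital ⇒ asymptotic needs convergence IN THE SAME gauge); DHRT arXiv:2104.08222, §1.
[cite: DafermosHolzegelRodnianskiTaylor2021, §1] -/
theorem stub_upgradeUniform :
    ∀ (X : Type) [TopologicalSpace X] [ChartedSpace E3 X] [IsManifold (𝓡 3) ∞ X] [T2Space X]
      [SecondCountableTopology X] [ConnectedSpace X],
      ∀ D ∈ admissibleVacuumData X, ∀ 𝒟 : VacuumCauchyDevelopment D, 𝒟.IsMaximal →
        ∀ (N₀ : ℕ) (m₁ χ₁ : ℝ), 0 < m₁ → χ₁ < 1 →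
          (∃ (O : Set 𝒟.carrier) (q : QuasiFinalStateDecomposition 𝒟.toSpacetime O 2 ⊤)
              (R : Fin q.N → ℝ → ℝ),
              q.N ≤ N₀ ∧ (∀ i, m₁ ≤ q.mass i ∧ q.mass i ≤ m₁⁻¹ ∧ |q.spin i| ≤ χ₁ * q.mass i) ∧
                O = Summit.FinalStateConjecture.exteriorOf 𝒟.toCauchyDevelopment q.charted ∧
                (∀ τ₁ : ℝ, q.τ₀ < τ₁ →
                  O \ q.certifiedLate R τ₁ ⊆
                    𝒟.metric.causalPast 𝒟.timeOrientation (q.certifiedSlab R τ₁)) ∧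
                ∀ δ : ℝ≥0∞, 0 < δ →
                  (∀ i (R' : ℝ), ∀ᶠ τ in atTop,
                    𝒟.toSpacetime.truncDeviationCk (q.background i) (q.chart i) 2 R' τ ≤ δ) ∧
                  (∀ᶠ τ in atTop,
                    𝒟.toSpacetime.deviationCk (Minkowski.backgroundOn q.flatDomain) q.flatChart 2 τ ≤
                      δ) ∧
                  (∀ i, ∀ᶠ τ in atTop,
                    𝒟.toSpacetime.truncDeviationCk (q.background i) (q.chart i) 2 (R i τ) τ ≤ δ)) →
            ∃ (O : Set 𝒟.carrier) (d : FinalStateDecomposition 𝒟.toSpacetime O 2),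
              (∀ i, Kerr.IsSubextremal (d.mass i) (d.spin i)) ∧
                O = Summit.FinalStateConjecture.exteriorOf 𝒟.toCauchyDevelopment d.charted ∧
                  Summit.FinalStateConjecture.HasExhaustiveCharts d := by
  intro X _ _ _ _ _ _ D _ 𝒟 _ N₀ m₁ χ₁ hm₁ hχ₁ h
  obtain ⟨O, q, R, -, hwin, hO, hcov, hall⟩ := h
  have h₁ : ∀ i (R' : ℝ), Tendsto
      (fun τ ↦ 𝒟.toSpacetime.truncDeviationCk (q.background i) (q.chart i) 2 R' τ) atTop (𝓝 0) :=
    fun i R' ↦ ENNReal.tendsto_nhds_zero.2 fun δ hδ ↦ (hall δ hδ).1 i R'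
  have h₃ : ∀ i, Tendsto
      (fun τ ↦ 𝒟.toSpacetime.truncDeviationCk (q.background i) (q.chart i) 2 (R i τ) τ)
        atTop (𝓝 0) :=
    fun i ↦ ENNReal.tendsto_nhds_zero.2 fun δ hδ ↦ (hall δ hδ).2.2 i
  -- diagonal growth: integer radii `g i τ → ∞` with the deviation out to `g i τ` still `→ 0`
  choose g hg hg₀ using fun i ↦ exists_nat_radius_tendsto fun n : ℕ ↦ h₁ i n
  have hmono : ∀ i (τ : ℝ), Monotone
      fun ρ : ℝ ↦ 𝒟.toSpacetime.truncDeviationCk (q.background i) (q.chart i) 2 ρ τ :=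
    fun i τ a b hab ↦ 𝒟.toSpacetime.truncDeviationCk_mono _ _ _ hab τ
  refine ⟨O,
    q.toFinalStateDecomposition h₁ (ENNReal.tendsto_nhds_zero.2 fun δ hδ ↦ (hall δ hδ).2.1),
    fun i ↦ ?_, hO,
    fun i τ ↦ max (R i τ) (max (g i τ : ℝ) (max (Kerr.rPlus (q.mass i) (q.spin i)) 0 + 1)),
    fun i ↦ ⟨?_, fun τ ↦ le_max_of_le_right (le_max_right _ _)⟩, fun i ↦ ?_, fun τ₁ hτ₁ x hx ↦ ?_⟩
  · -- sub-extremality from the window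
    obtain ⟨hm, -, ha⟩ := hwin i
    show |q.spin i| < q.mass i
    have hM : 0 < q.mass i := hm₁.trans_le hm
    calc |q.spin i| ≤ χ₁ * q.mass i := ha
      _ < 1 * q.mass i := mul_lt_mul_of_pos_right hχ₁ hM
      _ = q.mass i := one_mul _
  · -- the radii grow
    exact tendsto_atTop_mono (fun τ ↦ le_max_of_le_right (le_max_left _ _))
      (tendsto_natCast_atTop_atTop.comp (hg i))
  · -- convergence out to the new radii: monotone in the radius, each of the three pieces `→ 0`
    have hle : ∀ τ : ℝ,
        𝒟.toSpacetime.truncDeviationCk (q.background i) (q.chart i) 2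
            (max (R i τ) (max (g i τ : ℝ) (max (Kerr.rPlus (q.mass i) (q.spin i)) 0 + 1))) τ ≤
          max (𝒟.toSpacetime.truncDeviationCk (q.background i) (q.chart i) 2 (R i τ) τ)
            (max (𝒟.toSpacetime.truncDeviationCk (q.background i) (q.chart i) 2 (g i τ : ℝ) τ)
              (𝒟.toSpacetime.truncDeviationCk (q.background i) (q.chart i) 2
                (max (Kerr.rPlus (q.mass i) (q.spin i)) 0 + 1) τ)) := fun τ ↦
      ((hmono i τ).map_max).le.trans (max_le_max le_rfl ((hmono i τ).map_max).le)
    have hlim := (h₃ i).max ((hg₀ i).max (h₁ i (max (Kerr.rPlus (q.mass i) (q.spin i)) 0 + 1)))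
    rw [max_self, max_self] at hlim
    exact tendsto_of_tendsto_of_tendsto_of_le_of_le tendsto_const_nhds hlim (fun _ ↦ zero_le) hle
  · -- the covering clause is inherited: the certified regions grow with the radii
    have hRR' : ∀ i τ, R i τ ≤
        max (R i τ) (max (g i τ : ℝ) (max (Kerr.rPlus (q.mass i) (q.spin i)) 0 + 1)) :=
      fun i τ ↦ le_max_left _ _
    exact causalPast_mono _ (certifiedSlab_mono _ hRR' τ₁)
      (hcov τ₁ hτ₁ ⟨hx.1, fun hx' ↦ hx.2 (certifiedLate_mono _ hRR' τ₁ hx')⟩)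

end Summit.FinalStateConjecture.FinalStateConjecture.Theorems.BartnikGapSettling.Capture

end
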